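/-
Copyright (c) 2026 the pub-hodgecm-mathlib formalisation cell (harness21).  Prover seat hodgecm-mathlib-LH4-p08 (g3), req620 Track A «(D-RAM) FOUR-FRAME» squad
(unit U3_Laws, κ-STAGE B brick κB-H «CORE-HANGING κ-SOCKETS» AT VERTEX TYPE 2, dealer LH4-plan (g11) WORD #54∕#55 (2); letter of record LH4-p06 (g3)
`LETTER-kappaBH-tv2.v1.LH4p06g3.md` 44d44a13 (LH4-p05 (g3) ruling), class side LH4-p07 (g5) (prelude a20a711f); THIS FILE = κH₂-B2 «THE SOCKET ASSEMBLY, TYPE 2»).  2026-09-04.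
-/
import Summits.HodgeConjecture.HodgeConjecture.Theorems.F0P3cDyRamDiagonalKappaCoreHangingTwoClass          -- κH₂-A2 (LH4-p07 (g5)): `kappaCount_two_latt_coreHanging_eq`, `kappaCount_two_latt_rhoZeroH_eq_zero` (prelude a20a711f, letter 44d44a13 §3)
import Summits.HodgeConjecture.HodgeConjecture.Theorems.F0P3cDyRamDiagonalKappaCoreHangingCharacterSums      -- ★ p856738 κH-B1b (LH4-p06 (g3)): (T1) `finsum_chiH_admissible_eq_zero`, (T2a) `finsum_chiH_glue_eq_zero`, (T2b) `finsum_chiH_glue_eq_ncard_mul` — the SAME sums serve tv = 2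
import Summits.HodgeConjecture.HodgeConjecture.Theorems.F0P3cDyRamDiagonalKappaCoreHangingSocket                -- ★ p856750 κH-B2 (tv = 0, this seat): `v_glueUnit_letters` (reused, not restated)
import Summits.HodgeConjecture.HodgeConjecture.Theorems.F0P3cDyRamDiagonalCoreHangingSocketTypeTwo            -- ★ p856639 (E₂) (LH4-p07 (g4)): `stratumTwo_H_eq`, `stratumTwo_H_zero_eq`; brings ★ (C₂) `coreHangingTwoStratum_eq_iUnion_orbits` ∕ `pairwise_disjoint_orbits_two` ∕ `finsum_stabiliserWeight_orbit_two_eq`, ★ (D2₂) `…_glue`, ★ (D1₂) empties, ★ (H1a∕b), ★ `exists_fixed_near_glueUnit_iff_le`, ★ `trace_bound_of_isRamifiedQuadraticDatum`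
import HarnessLib

/-!
# Crux `H413`, line LH4 «(D-RAM) FOUR-FRAME» road — unit U3_Laws (iii), κ-STAGE B brick κB-H AT TYPE 2, FILE κH₂-B2 «THE κ-WEIGHTED COUNT OF THE TYPE-2 CORE-HANGING STRATA,
# ASSEMBLED»: `∑ᶠ_{M ∈ 𝒮_H₂(ρ)} κ₂,i(M)·w(M)` orbit by orbit — the `tv = 2` twin of ★ p856750 `…KappaCoreHangingSocket`

Cell `hodgecm-mathlib` (D-0151), FLOOR 0, crux item H413 = `stmt-HodgeConjecture-24833`, route of record `HCCMUnconditional`; squad F0∕P3c∕LH4 (req618∕req620).  THEOREMS ONLY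
(no `def`, no instance, no notation, no `sorry`, default heartbeats); lane `--supports stmt-HodgeConjecture-24833 --as helper` (count-neutral).  LAW-FREE.

THE OBJECT (letter of record 44d44a13 §3–§4; LH4-p09 (g3) letter 4ddd76e2 «=» up to one glue token; LH4-p05 (g3) ruling).  The type-2 core-hanging stratum
`𝒮_H₂(ρ) = {latt (1 0 0; x ϖ^ρ 0; xζ+y″ ϖ^ρζ ϖ^{2ρ+1}) : |x| = |ζ| = |y″| = |xζ+y″| = 1, T-stable, type-2 polarisable}` (axis `(2ρ+1, 2ρ+1, 2ρ+1)`) decomposes into the unit-torus orbits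
of `latt V_H₂(1,1,g)`, `g` over the admissible resp. glue classes of a representative system `R` mod `𝔭^ρ` (★ (C₂)∕(D2₂), LH4-p07 (g4)); on the orbit of `g` the type-2 κ-count is
`c₂,i(g) = [2d−1 ≤ ρ]·n₂(ρ)·χ^H_i(g)`, `n₂(ρ) = q^{⌈(ρ+2)∕2⌉−⌈(ρ+1)∕2⌉}` (κH₂-A2, LH4-p07 (g5)), and `n₂·(type-2 orbit mass) = q^{2ρ+1−⌈(ρ+2)∕2⌉}·n₂`.  THIS FILE assembles:
* §1 `finsum_kappaCount_mul_stabiliserWeight_orbit_two_eq` — `∑ᶠ_{orbit} κ₂,i·w = (c₂,i(g) : ℚ) · ‹★ (C₂) orbit mass›`.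
* §2 TUBE `finsum_kappaCount_mul_stabiliserWeight_coreHangingTwoStratum_tube` — `= 0` (★ κH-B1b (T1); dead window trivially).
* §3 GLUE `finsum_kappaCount_mul_stabiliserWeight_coreHangingTwoStratum_glue` — `= [2d−1 ≤ e]·χ^H_i(f₀)·q^{2ρ+1−⌈e∕2⌉}`, `e = 2ρ+1−m` (★ (T2a)∕(T2b), ★ (D1) `ncard_glue_representatives_eq`,
  (D2₂)'s arithmetic); `…_glue_eq_zero` when the glue unit is not `F`-rational.
* §4 HEAD **`finsum_kappaCount_mul_stabiliserWeight_hasAxis_H_two`** — letter 44d44a13 §4 VERBATIM: over `stratumTwo σ ϖ T ![2ρ+1, 2ρ+1, 2ρ+1]`, every `ρ : ℕ`, NO tube summand,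
  NO `ρ = 0` summand (the root stratum `H(1)` is κ-dead: κH₂-A2 `kappaCount_two_latt_rhoZeroH_eq_zero`), the equilateral glue `χ^H_i(f₀)·q^{2ρ+1−⌈(2ρ+1−m)∕2⌉}` under the extra
  conjunct `d ≤ ⌈(2ρ+1−m)∕2⌉`; case tree = ★ (E₂) `finsum_polarisationCount_mul_stabiliserWeight_hasAxis_H` token for token.
HONEST LABEL.  Count-neutral (`--supports`); (KMS)∕(KSS) stay PROVER TARGETS; `HC_CM` is proved only modulo the 7 printed citations (2 remaining named inputs:
hLiu418 = `stmt-HodgeConjecture-24832`, h413 = `stmt-HodgeConjecture-24833`) until rung 0 closes.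

## References
* [Kottwitz1986BaseChangeUnits] R. E. Kottwitz, *Base change for unit elements of Hecke algebras*, Compositio Math. 60 (1986), §1 pp. 240–241 (κ-orbital integrals of units as signed
  lattice counts modulo the torus).
* [LanglandsShelstad1987] R. P. Langlands, D. Shelstad, *On the definition of transfer factors*, Math. Ann. 278 (1987), §3 (κ as a character of `H¹(F, T)`).
* [Rogawski1990] J. D. Rogawski, *Automorphic Representations of Unitary Groups in Three Variables*, Ann. of Math. Stud. 123 (1990), §4.9 Prop. 4.9.1 (a) p. 55.
-/

set_option autoImplicit false

noncomputable section

namespace Summit.HodgeConjecture.HodgeConjecture.Cruxes.H413.F0P3cDyRamDiagonalKappaCoreHangingTwoSocket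

open Matrix WithZero
open Literature.NumberTheory.Automorphic Literature.NumberTheory.Automorphic.HermitianLattice Literature.NumberTheory.Automorphic.UnitaryGroup
open Literature.NumberTheory.Automorphic.UnitaryLatticeTree Literature.NumberTheory.Automorphic.UnitaryThreeFourFrame
open Literature.NumberTheory.LocalFields.WildQuadraticDatum
open Summit.HodgeConjecture.HodgeConjecture.Cruxes.H413.F0P3cDyRamDiagonalTorusDefs
open Summit.HodgeConjecture.HodgeConjecture.Cruxes.H413.F0P3cDyRamDiagonalStrataDefs
open Summit.HodgeConjecture.HodgeConjecture.Cruxes.H413.F0P3cDyRamDiagonalGluedStabiliserIndex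
open Summit.HodgeConjecture.HodgeConjecture.Cruxes.H413.F0P3cDyRamDiagonalGluedStabiliserIndexFull
open Summit.HodgeConjecture.HodgeConjecture.Cruxes.H413.F0P3cDyRamDiagonalGluedTorusOrbits
open Summit.HodgeConjecture.HodgeConjecture.Cruxes.H413.F0P3cDyRamDiagonalGluedClassRepresentatives
open Summit.HodgeConjecture.HodgeConjecture.Cruxes.H413.F0P3cDyRamDiagonalCoreHangingOrbits
open Summit.HodgeConjecture.HodgeConjecture.Cruxes.H413.F0P3cDyRamDiagonalGluedStabiliserIndexFullCorner
open Summit.HodgeConjecture.HodgeConjecture.Cruxes.H413.F0P3cDyRamDiagonalCoreHangingFoot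
open Summit.HodgeConjecture.HodgeConjecture.Cruxes.H413.F0P3cDyRamDiagonalCoreHangingGlueCount
open Summit.HodgeConjecture.HodgeConjecture.Cruxes.H413.F0P3cDyRamDiagonalCoreHangingCountTypeTwo
open Summit.HodgeConjecture.HodgeConjecture.Cruxes.H413.F0P3cDyRamDiagonalCoreHangingFootTypeTwo
open Summit.HodgeConjecture.HodgeConjecture.Cruxes.H413.F0P3cDyRamDiagonalCoreHangingGlueCountTypeTwo
open Summit.HodgeConjecture.HodgeConjecture.Cruxes.H413.F0P3cDyRamDiagonalCoreHangingSocketTypeTwo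
open Summit.HodgeConjecture.HodgeConjecture.Cruxes.H413.F0P3cDyRamElementDatumParity
open Summit.HodgeConjecture.HodgeConjecture.Cruxes.H413.F0P3cDyRamGlueUnitRationalityDepth
open Summit.HodgeConjecture.HodgeConjecture.Cruxes.H413.F0P3cDyRamDiagonalKappaCountDefs
open Summit.HodgeConjecture.HodgeConjecture.Cruxes.H413.F0P3cDyRamDiagonalKappaCoreHangingTwoClass
open Summit.HodgeConjecture.HodgeConjecture.Cruxes.H413.F0P3cDyRamDiagonalKappaCoreHangingCharacterSums
open scoped Valued WithZero Matrix MatrixGroups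

variable {K : Type} [Field K] [Valued K ℤᵐ⁰]

/-! ## §0  Finiteness of the torus orbits -/

/-- The unit-torus orbit of `latt V_H(1,1,g)` (`|g| = 1`, `ρ ≥ 1`) is finite (★ `ncard_unitTorus_orbit_latt_glued_typeTwo_eq` at `s = 0`). [cite: Kottwitz1986BaseChangeUnits, §1 pp. 240–241] -/
theorem finite_orbit_two [Finite 𝓀[K]] {ϖ : K} (hϖ : Valued.v ϖ = WithZero.exp (-1 : ℤ)) {ρ : ℕ} (hρ : 1 ≤ ρ) {g : K} (hvg : Valued.v g = 1) :
    {M : Submodule 𝒪[K] (Fin 3 → K) | ∃ u ∈ unitTorus K 3,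
      M = mapGL (diagGLUnits u) (latt (!![1, 0, 0; 1, ϖ ^ ρ, 0; 1 * 1 + g, ϖ ^ ρ * 1, ϖ ^ (2 * ρ + 1)] : Matrix (Fin 3) (Fin 3) K))}.Finite := by
  obtain ⟨hϖ0, -⟩ := ne_zero_and_v_lt_one_of_v_eq_exp hϖ
  have hq : 1 < Nat.card 𝓀[K] := Finite.one_lt_card
  obtain ⟨V₀, hV₀⟩ := exists_gl_coe_eq_glued (1 : K) 1 g (pow_ne_zero ρ hϖ0) (pow_ne_zero (2 * ρ + 1) hϖ0)
  have hV0 : (V₀ : Matrix (Fin 3) (Fin 3) K) = !![1, 0, 0; 1, ϖ ^ ρ, 0; 1 * 1 + g, ϖ ^ ρ * 1, ϖ ^ (2 * ρ + 1 + 0)] := by rw [Nat.add_zero]; exact hV₀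
  have hcard := ncard_unitTorus_orbit_latt_glued_typeTwo_eq hϖ hρ 0 (map_one _) (map_one _) (by rw [pow_zero]; exact hvg) V₀ hV0
  rw [← hV₀]
  refine Set.finite_of_ncard_ne_zero ?_
  rw [hcard]
  exact mul_ne_zero (mul_ne_zero (by omega) (pow_ne_zero _ (by omega))) (mul_ne_zero (by omega) (pow_ne_zero _ (by omega)))

/-! ## §1  One orbit: the κ-count is constant by value along `𝒯·latt V_H(1,1,g)` -/

/-- **THE κ-WEIGHTED MASS OF ONE ORBIT**: for a fixed unit `g` with `|1 + g| = 1`, every member of the unit-torus orbit `𝒯·latt V_H(1,1,g)` is a core-hanging lattice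
`latt (1 0 0; x ϖ^ρ 0; xζ + g·xζ ϖ^ρζ ϖ^{2ρ+1})` with the EXACT invariant `g` (★ (A) `exists_coreHanging_of_mem_orbit`), so κH₂-A2 gives `kappaCount σ ϖ 2 i M = [2d−1 ≤ ρ]·n₂(ρ)·χ^H_i(g)` on the
whole orbit, and `∑ᶠ_{orbit} κ₂,i·w = c₂,i(g) · ∑ᶠ_{orbit} w`, the second factor being ★ (C₂) `finsum_stabiliserWeight_orbit_two_eq`. [cite: Kottwitz1986BaseChangeUnits, §1 pp. 240–241] [cite: LanglandsShelstad1987, §3] -/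
theorem finsum_kappaCount_mul_stabiliserWeight_orbit_two_eq [CompleteSpace K] [Finite 𝓀[K]] {σ : K →+* K} {ϖ : K} {d t : ℕ}
    (hD : IsRamifiedQuadraticDatum σ ϖ d t) (h2 : Valued.v (2 : K) < 1) {ρ : ℕ} (hρ : 1 ≤ ρ) {g : K} (hσg : σ g = g) (hvg : Valued.v g = 1) (h1g : Valued.v (1 + g) = 1) (i : Fin 3) :
    ∑ᶠ M ∈ {M : Submodule 𝒪[K] (Fin 3 → K) | ∃ u ∈ unitTorus K 3, M = mapGL (diagGLUnits u) (latt (!![1, 0, 0; 1, ϖ ^ ρ, 0; 1 * 1 + g, ϖ ^ ρ * 1, ϖ ^ (2 * ρ + 1)] : Matrix (Fin 3) (Fin 3) K))},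
        (kappaCount σ ϖ 2 i M : ℚ) * stabiliserWeight σ M =
      (((if 2 * d - 1 ≤ ρ then ((Nat.card 𝓀[K] ^ ((ρ + 2) / 2 - (ρ + 1) / 2) : ℕ) : ℤ) * (![normSign σ (-(1 + g)), normSign σ g * normSign σ (-(1 + g)), normSign σ g] : Fin 3 → ℤ) i else 0) : ℤ) : ℚ) *
        (((((Nat.card 𝓀[K] - 1) * Nat.card 𝓀[K] ^ ρ) * ((Nat.card 𝓀[K] - 1) * Nat.card 𝓀[K] ^ (2 * ρ)) : ℕ) : ℚ) *
          ((((Nat.card 𝓀[K] - 1) * Nat.card 𝓀[K] ^ ((ρ + 2) / 2 - 1)) * ((Nat.card 𝓀[K] - 1) * Nat.card 𝓀[K] ^ ρ) : ℕ) : ℚ)⁻¹) := by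
  have hTr := trace_bound_of_isRamifiedQuadraticDatum hD h2
  obtain ⟨hσ, hvσ, hϖ, hfix, hd, -, -⟩ := id hD
  obtain ⟨hϖ0, -⟩ := ne_zero_and_v_lt_one_of_v_eq_exp hϖ
  -- κ is constant on the orbit, by value
  have hconst : ∀ M ∈ {M : Submodule 𝒪[K] (Fin 3 → K) | ∃ u ∈ unitTorus K 3,
        M = mapGL (diagGLUnits u) (latt (!![1, 0, 0; 1, ϖ ^ ρ, 0; 1 * 1 + g, ϖ ^ ρ * 1, ϖ ^ (2 * ρ + 1)] : Matrix (Fin 3) (Fin 3) K))},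
      (kappaCount σ ϖ 2 i M : ℚ) =
        (((if 2 * d - 1 ≤ ρ then ((Nat.card 𝓀[K] ^ ((ρ + 2) / 2 - (ρ + 1) / 2) : ℕ) : ℤ) * (![normSign σ (-(1 + g)), normSign σ g * normSign σ (-(1 + g)), normSign σ g] : Fin 3 → ℤ) i else 0) : ℤ) : ℚ) := by
    rintro M ⟨u, hu, rfl⟩
    obtain ⟨V₀, hV₀⟩ := exists_gl_coe_eq_glued (1 : K) 1 g (pow_ne_zero ρ hϖ0) (pow_ne_zero (2 * ρ + 1) hϖ0)
    obtain ⟨x', ζ', y₁, hx', hζ', -, -, hκ, hM⟩ := exists_coreHanging_of_mem_orbit u hu hvg h1g (ϖ ^ ρ) (ϖ ^ (2 * ρ + 1)) V₀ hV₀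
    have hx0 : x' ≠ 0 := fun h0 => by rw [h0, map_zero] at hx'; exact zero_ne_one hx'
    have hζ0 : ζ' ≠ 0 := fun h0 => by rw [h0, map_zero] at hζ'; exact zero_ne_one hζ'
    have hy₁ : y₁ = g * (x' * ζ') := by rw [← hκ]; field_simp
    obtain ⟨V, hV⟩ := exists_gl_coe_eq_glued x' ζ' (g * (x' * ζ')) (pow_ne_zero ρ hϖ0) (pow_ne_zero (2 * ρ + 1) hϖ0)
    rw [← hV₀, hM, hy₁, ← hV, kappaCount_two_latt_coreHanging_eq hD h2 hTr hρ hx' hζ' hσg hvg h1g V hV i]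
  rw [← finsum_stabiliserWeight_orbit_two_eq hσ hvσ hfix hϖ hd hρ hσg hvg, mul_finsum_mem]
  exact finsum_mem_congr rfl fun M hM => by rw [hconst M hM]

/-! ## §2  TUBE regime: the κ-weighted count vanishes -/

/-- **TUBE REGIME (`2ρ+1 ≤ n₁, n₂`, `ρ ≤ n₃`): `∑ᶠ_{M ∈ 𝒮_H₂(ρ)} κ₂,i(M)·w(M) = 0`.**  Orbit by orbit over the admissible classes (★ (C₂)): `Σ_{g ∈ R, |1+g| = 1} c₂,i(g)·mass₂`; in the
alive window `2d−1 ≤ ρ` this is `n₂·mass₂ · Σ χ^H_i(g) = 0` by κH-B1b (T1) (ω is a NON-trivial character on `U_F∕U_F(ρ)` and on `U_{F,1}∕U_F(ρ)` — the wild fence `|2| < 1` makes its conductor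
`≥ 2`); in the dead window every `c₂,i(g) = 0`.  (TAME contrast: with `d = 1` the tube would NOT cancel.) [cite: Kottwitz1986BaseChangeUnits, §1 pp. 240–241] [cite: LanglandsShelstad1987, §3] -/
theorem finsum_kappaCount_mul_stabiliserWeight_coreHangingTwoStratum_tube [CompleteSpace K] [Finite 𝓀[K]] {σ : K →+* K} {ϖ : K} {d t : ℕ}
    (hD : IsRamifiedQuadraticDatum σ ϖ d t) (h2 : Valued.v (2 : K) < 1)
    (T : GL (Fin 3) K) {α β : K} (hT : (T : Matrix (Fin 3) (Fin 3) K) = Matrix.diagonal ![α, β, 1]) (hα : Valued.v α = 1) (hβ : Valued.v β = 1)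
    {n₁ n₂ n₃ : ℕ} (h₁ : Valued.v (β - 1) = Valued.v ϖ ^ n₁) (h₂ : Valued.v (α - 1) = Valued.v ϖ ^ n₂) (h₃ : Valued.v (β - α) = Valued.v ϖ ^ n₃)
    {ρ : ℕ} (hρ : 1 ≤ ρ) (hρ₁ : 2 * ρ + 1 ≤ n₁) (hρ₂ : 2 * ρ + 1 ≤ n₂) (hρ₃ : ρ ≤ n₃) (i : Fin 3) :
    ∑ᶠ M ∈ {M : Submodule 𝒪[K] (Fin 3 → K) | M ∈ normalisedStableLattices T ∧ IsTypeTwoPolarisable σ ϖ M ∧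
        ∃ x ζ y'' : K, Valued.v x = 1 ∧ Valued.v ζ = 1 ∧ Valued.v y'' = 1 ∧ Valued.v (x * ζ + y'') = 1 ∧
          M = latt (!![1, 0, 0; x, ϖ ^ ρ, 0; x * ζ + y'', ϖ ^ ρ * ζ, ϖ ^ (2 * ρ + 1)] : Matrix (Fin 3) (Fin 3) K)},
        (kappaCount σ ϖ 2 i M : ℚ) * stabiliserWeight σ M = 0 := by
  have hTr := trace_bound_of_isRamifiedQuadraticDatum hD h2
  obtain ⟨hσ, hvσ, hϖ, hfix, hd, -, -⟩ := id hD
  -- representatives of the fixed units mod `𝔭^ρ` (★ (iv-c) at `t = 0`)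
  obtain ⟨R, hRfin, hRcard, hR1, hR2, hR3⟩ := exists_fixed_class_representatives hσ hvσ hfix hϖ hd ρ 0 hρ
  simp only [Nat.mul_zero, pow_zero, Nat.add_zero] at hR1 hR2 hR3
  have hRadmfin : {g : K | g ∈ R ∧ Valued.v (1 + g) = 1}.Finite := hRfin.subset (Set.sep_subset _ _)
  -- decompose and sum orbit by orbit
  rw [coreHangingTwoStratum_eq_iUnion_orbits hσ hvσ hϖ hTr T hT hα hβ h₁ h₂ h₃ hρ hρ₁ hρ₂ hρ₃ hR1 hR2,
    finsum_mem_biUnion (pairwise_disjoint_orbits_two hϖ ρ (fun g hg => (hR1 g hg).2) hR3) hRadmfin (fun g hg => finite_orbit_two hϖ hρ (hR1 _ hg.1).2),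
    finsum_mem_congr rfl (fun g hg => finsum_kappaCount_mul_stabiliserWeight_orbit_two_eq hD h2 hρ (hR1 _ hg.1).1 (hR1 _ hg.1).2 hg.2 i),
    ← finsum_mem_mul]
  by_cases halive : 2 * d - 1 ≤ ρ
  · simp only [if_pos halive, Int.cast_mul, Int.cast_natCast]
    rw [← mul_finsum_mem, finsum_chiH_admissible_eq_zero hD h2 halive hRfin hR1 hR2 hR3 i, mul_zero, zero_mul]
  · simp only [if_neg halive, Int.cast_zero]
    rw [show (∑ᶠ g ∈ {g : K | g ∈ R ∧ Valued.v (1 + g) = 1}, (0 : ℚ)) = 0 by simp, zero_mul]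

/-! ## §3  EQUILATERAL GLUE regime -/

/-- **EQUILATERAL GLUE (`n₁ = n₂ = n₃ = m`, `ρ+1 ≤ m < 2ρ+1`, glue unit `F`-rational to depth `e = 2ρ+1−m` with witness `f₀`):
`∑ᶠ_{M ∈ 𝒮_H₂(ρ)} κ₂,i(M)·w(M) = [2d−1 ≤ e] · χ^H_i(f₀) · q^{2ρ+1−⌈e∕2⌉}`.**  Orbit by orbit over the glue ball `R_glue = {g ∈ R : |g + g₀| ≤ |ϖ|^e}` (★ (D2₂)):
`Σ_{g ∈ R_glue} c₂,i(g)·mass₂`; dead window (`ρ < 2d−1`): all `c₂,i = 0`; alive but `e ≤ 2d−2`: `n₂·mass₂·Σ χ^H_i = 0` (κH-B1b (T2a)); `2d−1 ≤ e`: `Σ χ^H_i = #R_glue·χ^H_i(f₀)`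
(κH-B1b (T2b)) and `n₂·#R_glue·mass₂ = q^{⌈(ρ+1)∕2⌉−⌈ρ∕2⌉}·q^{⌈ρ∕2⌉−⌈e∕2⌉}·q^{2ρ+1−⌈(ρ+1)∕2⌉} = q^{2ρ+1−⌈e∕2⌉}` (★ (D1), ★ (C₂)) — the ★ (D2₂) glue mass, as it must be (every class carries the same `χ^H_i(f₀)`). [cite: Kottwitz1986BaseChangeUnits, §1 pp. 240–241] [cite: LanglandsShelstad1987, §3] [cite: Rogawski1990, §4.9 Prop. 4.9.1 (a) p. 55] -/
theorem finsum_kappaCount_mul_stabiliserWeight_coreHangingTwoStratum_glue [CompleteSpace K] [Finite 𝓀[K]] {σ : K →+* K} {ϖ : K} {d t : ℕ}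
    (hD : IsRamifiedQuadraticDatum σ ϖ d t) (h2 : Valued.v (2 : K) < 1)
    (T : GL (Fin 3) K) {α β : K} (hT : (T : Matrix (Fin 3) (Fin 3) K) = Matrix.diagonal ![α, β, 1]) (hα : Valued.v α = 1) (hβ : Valued.v β = 1)
    {m : ℕ} (h₁ : Valued.v (β - 1) = Valued.v ϖ ^ m) (h₂ : Valued.v (α - 1) = Valued.v ϖ ^ m) (h₃ : Valued.v (β - α) = Valued.v ϖ ^ m)
    {ρ : ℕ} (hρ : 1 ≤ ρ) (hρm : ρ + 1 ≤ m) (hm : m < 2 * ρ + 1)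
    {f₀ : K} (hσf₀ : σ f₀ = f₀) (hf₀ : Valued.v (f₀ + (β - 1) / (α - 1)) ≤ Valued.v ϖ ^ (2 * ρ + 1 - m)) (i : Fin 3) :
    ∑ᶠ M ∈ {M : Submodule 𝒪[K] (Fin 3 → K) | M ∈ normalisedStableLattices T ∧ IsTypeTwoPolarisable σ ϖ M ∧
        ∃ x ζ y'' : K, Valued.v x = 1 ∧ Valued.v ζ = 1 ∧ Valued.v y'' = 1 ∧ Valued.v (x * ζ + y'') = 1 ∧
          M = latt (!![1, 0, 0; x, ϖ ^ ρ, 0; x * ζ + y'', ϖ ^ ρ * ζ, ϖ ^ (2 * ρ + 1)] : Matrix (Fin 3) (Fin 3) K)},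
        (kappaCount σ ϖ 2 i M : ℚ) * stabiliserWeight σ M =
      if 2 * d - 1 ≤ 2 * ρ + 1 - m then
        (((![normSign σ (-(1 + f₀)), normSign σ f₀ * normSign σ (-(1 + f₀)), normSign σ f₀] : Fin 3 → ℤ) i : ℤ) : ℚ) *
          (Nat.card 𝓀[K] : ℚ) ^ (2 * ρ + 1 - (2 * ρ + 1 - m + 1) / 2)
      else 0 := by
  have hTr := trace_bound_of_isRamifiedQuadraticDatum hD h2
  obtain ⟨hσ, hvσ, hϖ, hfix, hd, -, -⟩ := id hD
  obtain ⟨hϖ0, hϖ1⟩ := ne_zero_and_v_lt_one_of_v_eq_exp hϖ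
  have hq : 1 < Nat.card 𝓀[K] := Finite.one_lt_card
  have he1 : 1 ≤ 2 * ρ + 1 - m := by omega
  have heρ : 2 * ρ + 1 - m ≤ ρ := by omega
  obtain ⟨hg₀, h1g₀⟩ := F0P3cDyRamDiagonalKappaCoreHangingSocket.v_glueUnit_letters hϖ0 h₁ h₂ h₃
  -- representatives and the glue ball
  obtain ⟨R, hRfin, -, hR1, hR2, hR3⟩ := exists_fixed_class_representatives hσ hvσ hfix hϖ hd ρ 0 hρ
  simp only [Nat.mul_zero, pow_zero, Nat.add_zero] at hR1 hR2 hR3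
  have hglue := ncard_glue_representatives_eq hσ hvσ hfix hϖ hd he1 heρ hRfin hR1 hR2 hR3 hg₀ hσf₀ hf₀
  have hRgfin : {g : K | g ∈ R ∧ Valued.v (g + (β - 1) / (α - 1)) ≤ Valued.v ϖ ^ (2 * ρ + 1 - m)}.Finite := hRfin.subset (Set.sep_subset _ _)
  rw [coreHangingTwoStratum_eq_iUnion_orbits_glue hσ hvσ hϖ hTr T hT hα hβ h₁ h₂ h₃ hρ hρm hm hR1 hR2,
    finsum_mem_biUnion (pairwise_disjoint_orbits_two_of hϖ ρ (Set.sep_subset _ _) (fun g hg => (hR1 g hg).2)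
      (fun g hg => v_one_add_eq_one_of_glue hϖ h₂ h₃ he1 hg.2) hR3) hRgfin (fun g hg => finite_orbit_two hϖ hρ (hR1 _ hg.1).2),
    finsum_mem_congr rfl (fun g hg => finsum_kappaCount_mul_stabiliserWeight_orbit_two_eq hD h2 hρ (hR1 _ hg.1).1 (hR1 _ hg.1).2
      (v_one_add_eq_one_of_glue hϖ h₂ h₃ he1 hg.2) i),
    ← finsum_mem_mul]
  by_cases halive : 2 * d - 1 ≤ ρ
  · simp only [if_pos halive]
    by_cases he : 2 * d - 1 ≤ 2 * ρ + 1 - m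
    · -- ω is TRIVIAL on the glue ball: every class carries `n₂·χ^H_i(f₀)`
      simp only [Int.cast_mul, Int.cast_natCast]
      rw [if_pos he, ← mul_finsum_mem, finsum_chiH_glue_eq_ncard_mul hD hRfin hR1 hg₀ h1g₀ he hσf₀ hf₀ i, hglue]
      -- arithmetic: `n₂·#R_glue·mass₂ = q^{2ρ+1−⌈e∕2⌉}` (`n₂ = q^{a₂−a}`, `#R_glue = q^{a−b}`, `mass₂ = q^{2ρ}∕q^{a₂−1}`; `a = ⌈ρ∕2⌉`, `a₂ = ⌈(ρ+1)∕2⌉`, `b = ⌈e∕2⌉`)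
      have hq1 : ((Nat.card 𝓀[K] : ℚ) - 1) ≠ 0 := by
        have : (1 : ℚ) < Nat.card 𝓀[K] := by exact_mod_cast hq
        linarith
      have hq0 : (Nat.card 𝓀[K] : ℚ) ≠ 0 := by exact_mod_cast (by omega : Nat.card 𝓀[K] ≠ 0)
      have hden : ((((Nat.card 𝓀[K] - 1) * Nat.card 𝓀[K] ^ ((ρ + 2) / 2 - 1)) * ((Nat.card 𝓀[K] - 1) * Nat.card 𝓀[K] ^ ρ) : ℕ) : ℚ) ≠ 0 := by
        push_cast [Nat.cast_sub hq.le]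
        exact mul_ne_zero (mul_ne_zero hq1 (pow_ne_zero _ hq0)) (mul_ne_zero hq1 (pow_ne_zero _ hq0))
      have key : (Nat.card 𝓀[K] : ℚ) ^ ((ρ + 2) / 2 - (ρ + 1) / 2) * (Nat.card 𝓀[K] : ℚ) ^ ((ρ + 1) / 2 - (2 * ρ + 1 - m + 1) / 2) *
            (Nat.card 𝓀[K] : ℚ) ^ ρ * (Nat.card 𝓀[K] : ℚ) ^ (2 * ρ) =
          (Nat.card 𝓀[K] : ℚ) ^ (2 * ρ + 1 - (2 * ρ + 1 - m + 1) / 2) * (Nat.card 𝓀[K] : ℚ) ^ ((ρ + 2) / 2 - 1) * (Nat.card 𝓀[K] : ℚ) ^ ρ := by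
        rw [← pow_add, ← pow_add, ← pow_add, ← pow_add, ← pow_add]
        congr 1
        omega
      have hmass : ((Nat.card 𝓀[K] ^ ((ρ + 2) / 2 - (ρ + 1) / 2) : ℕ) : ℚ) * ((Nat.card 𝓀[K] ^ ((ρ + 1) / 2 - (2 * ρ + 1 - m + 1) / 2) : ℕ) : ℚ) *
          (((((Nat.card 𝓀[K] - 1) * Nat.card 𝓀[K] ^ ρ) * ((Nat.card 𝓀[K] - 1) * Nat.card 𝓀[K] ^ (2 * ρ)) : ℕ) : ℚ) *
            ((((Nat.card 𝓀[K] - 1) * Nat.card 𝓀[K] ^ ((ρ + 2) / 2 - 1)) * ((Nat.card 𝓀[K] - 1) * Nat.card 𝓀[K] ^ ρ) : ℕ) : ℚ)⁻¹) =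
          (Nat.card 𝓀[K] : ℚ) ^ (2 * ρ + 1 - (2 * ρ + 1 - m + 1) / 2) := by
        rw [← mul_assoc, mul_inv_eq_iff_eq_mul₀ hden]
        push_cast [Nat.cast_sub hq.le]
        linear_combination ((Nat.card 𝓀[K] : ℚ) - 1) ^ 2 * key
      rw [show ∀ N A χ M : ℚ, N * (A * χ) * M = χ * (N * A * M) from fun N A χ M => by ring, hmass]
    · -- ω NON-trivial on the glue ball: cancellation (κH-B1 (T2a))
      simp only [Int.cast_mul, Int.cast_natCast]
      rw [if_neg he, ← mul_finsum_mem, finsum_chiH_glue_eq_zero hD h2 halive hRfin hR1 hR2 hR3 hg₀ h1g₀ he1 heρ (by omega) i, mul_zero, zero_mul]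
  · simp only [if_neg halive, Int.cast_zero]
    rw [if_neg (by omega), show (∑ᶠ g ∈ {g : K | g ∈ R ∧ Valued.v (g + (β - 1) / (α - 1)) ≤ Valued.v ϖ ^ (2 * ρ + 1 - m)}, (0 : ℚ)) = 0 by simp, zero_mul]

/-- **EQUILATERAL GLUE, glue unit NOT `F`-rational to depth `2ρ+1−m`: the κ-weighted count is `0`** (no orbit qualifies; ★ (D2₂) twin). [cite: Kottwitz1986BaseChangeUnits, §1 pp. 240–241] -/
theorem finsum_kappaCount_mul_stabiliserWeight_coreHangingTwoStratum_glue_eq_zero {σ : K →+* K} (hσ : ∀ a, σ (σ a) = a) (hvσ : ∀ a, Valued.v (σ a) = Valued.v a)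
    (hfix : ∀ x : K, σ x = x → x ≠ 0 → ∃ n : ℤ, Valued.v x = exp (2 * n)) {ϖ : K} (hϖ : Valued.v ϖ = exp (-1 : ℤ))
    {d : ℕ} (hd : Valued.v (ϖ - σ ϖ) = Valued.v ϖ ^ d) (hTr : ∀ a : K, Valued.v (a + σ a) ≤ Valued.v ϖ * Valued.v a) [Finite 𝓀[K]]
    (T : GL (Fin 3) K) {α β : K} (hT : (T : Matrix (Fin 3) (Fin 3) K) = Matrix.diagonal ![α, β, 1]) (hα : Valued.v α = 1) (hβ : Valued.v β = 1)
    {m : ℕ} (h₁ : Valued.v (β - 1) = Valued.v ϖ ^ m) (h₂ : Valued.v (α - 1) = Valued.v ϖ ^ m) (h₃ : Valued.v (β - α) = Valued.v ϖ ^ m)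
    {ρ : ℕ} (hρ : 1 ≤ ρ) (hρm : ρ + 1 ≤ m) (hm : m < 2 * ρ + 1)
    (hno : ¬ ∃ f : K, σ f = f ∧ Valued.v (f + (β - 1) / (α - 1)) ≤ Valued.v ϖ ^ (2 * ρ + 1 - m)) (i : Fin 3) :
    ∑ᶠ M ∈ {M : Submodule 𝒪[K] (Fin 3 → K) | M ∈ normalisedStableLattices T ∧ IsTypeTwoPolarisable σ ϖ M ∧
        ∃ x ζ y'' : K, Valued.v x = 1 ∧ Valued.v ζ = 1 ∧ Valued.v y'' = 1 ∧ Valued.v (x * ζ + y'') = 1 ∧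
          M = latt (!![1, 0, 0; x, ϖ ^ ρ, 0; x * ζ + y'', ϖ ^ ρ * ζ, ϖ ^ (2 * ρ + 1)] : Matrix (Fin 3) (Fin 3) K)},
        (kappaCount σ ϖ 2 i M : ℚ) * stabiliserWeight σ M = 0 := by
  obtain ⟨R, -, -, hR1, hR2, -⟩ := exists_fixed_class_representatives hσ hvσ hfix hϖ hd ρ 0 hρ
  simp only [Nat.mul_zero, pow_zero, Nat.add_zero] at hR1 hR2
  rw [coreHangingTwoStratum_eq_iUnion_orbits_glue hσ hvσ hϖ hTr T hT hα hβ h₁ h₂ h₃ hρ hρm hm hR1 hR2,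
    show {g : K | g ∈ R ∧ Valued.v (g + (β - 1) / (α - 1)) ≤ Valued.v ϖ ^ (2 * ρ + 1 - m)} = ∅ from glue_representatives_eq_empty hR1 hno]
  simp

/-! ## §4  HEAD — the κ-socket on the type-2 core-hanging strata -/

section Socket

variable [CompleteSpace K] [Fintype 𝓀[K]] {σ : K →+* K} {ϖ : K} {d t : ℕ} {α β : K} {N₀ n₁ n₂ n₃ : ℕ} {T : GL (Fin 3) K}

/-- **κB-H · THE κ-SOCKET ON THE TYPE-2 CORE-HANGING STRATUM `H(2ρ+1)`** (letter of record 44d44a13 §4 VERBATIM; LH4-p05 (g3) ruling WORD #55): under the B10∕Fκ5 binders and the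
glue-witness binder `f₀`, for EVERY `ρ : ℕ`:
`∑ᶠ_{M ∈ stratumTwo (2ρ+1,2ρ+1,2ρ+1)} κ₂,i(M)·w(M) = [n₁ = n₂ = n₃ =: m < 2ρ+1 ≤ 2m, 2ρ+1−m ≤ m−d+1, d ≤ ⌈(2ρ+1−m)∕2⌉] · χ^H_i(f₀) · q^{2ρ+1−⌈(2ρ+1−m)∕2⌉}` — NO tube summand
(wild cancellation, ★ κH-B1b (T1)), NO `ρ = 0` summand (the root stratum `H(1)` is κ-dead, κH₂-A2 `kappaCount_two_latt_rhoZeroH_eq_zero`); case tree = ★ (E₂) token for token.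
[cite: Rogawski1990, §4.9 Prop. 4.9.1 (a) p. 55] [cite: Kottwitz1986BaseChangeUnits, §1 pp. 240–241] [cite: LanglandsShelstad1987, §3] -/
theorem finsum_kappaCount_mul_stabiliserWeight_hasAxis_H_two (hD : IsRamifiedQuadraticDatum σ ϖ d t) (h2 : Valued.v (2 : K) < 1)
    (hE : IsElementDatum σ ϖ N₀ α β n₁ n₂ n₃) (hN₀ : d ≤ N₀) (hT : (T : Matrix (Fin 3) (Fin 3) K) = Matrix.diagonal ![α, β, 1]) (ρ : ℕ) (i : Fin 3)
    (f₀ : K) (hσf₀ : σ f₀ = f₀)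
    (hf₀ : n₁ = n₂ → n₂ = n₃ → n₁ < 2 * ρ + 1 → 2 * ρ + 1 ≤ 2 * n₁ → 2 * ρ + 1 - n₁ ≤ n₁ - d + 1 → Valued.v (f₀ + (β - 1) / (α - 1)) ≤ Valued.v ϖ ^ (2 * ρ + 1 - n₁)) :
    ∑ᶠ M ∈ stratumTwo σ ϖ T ![2 * ρ + 1, 2 * ρ + 1, 2 * ρ + 1], (kappaCount σ ϖ 2 i M : ℚ) * stabiliserWeight σ M =
      if n₁ = n₂ ∧ n₂ = n₃ ∧ n₁ < 2 * ρ + 1 ∧ 2 * ρ + 1 ≤ 2 * n₁ ∧ 2 * ρ + 1 - n₁ ≤ n₁ - d + 1 ∧ d ≤ (2 * ρ + 1 - n₁ + 1) / 2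
      then (((![normSign σ (-(1 + f₀)), normSign σ f₀ * normSign σ (-(1 + f₀)), normSign σ f₀] : Fin 3 → ℤ) i : ℤ) : ℚ) *
             (Fintype.card 𝓀[K] : ℚ) ^ (2 * ρ + 1 - (2 * ρ + 1 - n₁ + 1) / 2)
      else 0 := by
  have hTr := trace_bound_of_isRamifiedQuadraticDatum hD h2
  have hiso := isoceles_of_isElementDatum hD hE
  have hdmin := le_min_depth_of_isElementDatum hE hN₀
  obtain ⟨hσ, hvσ, hϖ, hfix, hd, hd1, -⟩ := id hD
  obtain ⟨hα1, hβ1, -, hαne, hβne, h₁, h₂, h₃, hN₁, hN₂, hN₃⟩ := hE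
  have hα : Valued.v α = 1 := UnitaryLatticeTree.v_eq_one_of_mul_map_eq_one hvσ hα1
  have hβ : Valued.v β = 1 := UnitaryLatticeTree.v_eq_one_of_mul_map_eq_one hvσ hβ1
  have h₃' : Valued.v (β - α) = Valued.v ϖ ^ n₃ := by rw [Valuation.map_sub_swap]; exact h₃
  have hcard : (Nat.card 𝓀[K] : ℚ) = Fintype.card 𝓀[K] := by rw [Nat.card_eq_fintype_card]
  obtain ⟨hϖ0, hϖ1⟩ := ne_zero_and_v_lt_one_of_v_eq_exp hϖ
  rcases Nat.eq_zero_or_pos ρ with rfl | hρ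
  · -- `ρ = 0`: the root stratum `H(1)` is κ-dead
    rw [if_neg (by omega), stratumTwo_H_zero_eq hvσ hfix hϖ T]
    have h0 : ∀ M ∈ {M : Submodule 𝒪[K] (Fin 3 → K) | M ∈ normalisedStableLattices T ∧ IsTypeTwoPolarisable σ ϖ M ∧
        ∃ y ζ : K, Valued.v y = 1 ∧ Valued.v ζ = 1 ∧ M = latt (!![1, 0, 0; 0, 1, 0; y, ζ, ϖ] : Matrix (Fin 3) (Fin 3) K)},
        (kappaCount σ ϖ 2 i M : ℚ) * stabiliserWeight σ M = 0 := by
      rintro M ⟨-, -, y, ζ, hy, hζ, rfl⟩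
      obtain ⟨W, hW'⟩ := exists_gl_coe_eq_glued (0 : K) ζ y one_ne_zero hϖ0
      have hW : (W : Matrix (Fin 3) (Fin 3) K) = !![1, 0, 0; 0, 1, 0; y, ζ, ϖ] := by rw [hW', zero_mul, zero_add, one_mul]
      rw [← hW, kappaCount_two_latt_rhoZeroH_eq_zero hD h2 hy hζ W hW i, Int.cast_zero, zero_mul]
    rw [finsum_mem_congr rfl h0]
    simp
  · -- `ρ ≥ 1`
    rw [stratumTwo_H_eq hvσ hfix hϖ T hρ]
    by_cases htube : 2 * ρ + 1 ≤ min n₁ (min n₂ n₃)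
    · -- the tube: wild cancellation
      rw [if_neg (by omega),
        finsum_kappaCount_mul_stabiliserWeight_coreHangingTwoStratum_tube hD h2 T hT hα hβ h₁ h₂ h₃' hρ (by omega) (by omega) (by omega) i]
    · by_cases h12 : n₁ = n₂
      · -- the foot `n₁ = n₂ = m`
        subst h12
        by_cases hρm : ρ + 1 ≤ n₁
        · by_cases h13 : n₁ = n₃
          · -- EQUILATERAL: `m < 2ρ+1` from `¬htube`
            subst h13
            have hm : n₁ < 2 * ρ + 1 := by omega
            have hαd : Valued.v (α - 1) ≤ Valued.v ϖ ^ d := by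
              rw [h₂, v_varpi_pow hϖ, v_varpi_pow hϖ, WithZero.exp_le_exp]; omega
            have hβd : Valued.v (β - 1) ≤ Valued.v ϖ ^ d := by
              rw [h₁, v_varpi_pow hϖ, v_varpi_pow hϖ, WithZero.exp_le_exp]; omega
            have hg₀ : Valued.v ((β - 1) / (α - 1)) = 1 := by
              have hvϖ : 0 < Valued.v ϖ := (Valuation.pos_iff _).2 hϖ0
              rw [map_div₀, h₁, h₂, div_self (pow_ne_zero _ hvϖ.ne')]
            have hswitch := exists_fixed_near_glueUnit_iff_le hσ hvσ hfix hϖ hd hd1 hα1 hβ1 hαne hβne hαd hβd h₃ (by omega) (2 * ρ + 1 - n₁)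
            rw [hg₀, one_mul] at hswitch
            by_cases hsw : 2 * ρ + 1 - n₁ ≤ n₁ - d + 1
            · rw [finsum_kappaCount_mul_stabiliserWeight_coreHangingTwoStratum_glue hD h2 T hT hα hβ h₁ h₂ h₃' hρ hρm hm hσf₀ (hf₀ rfl rfl hm (by omega) hsw) i, hcard]
              by_cases he : 2 * d - 1 ≤ 2 * ρ + 1 - n₁
              · rw [if_pos he, if_pos ⟨rfl, rfl, hm, by omega, hsw, by omega⟩]
              · rw [if_neg he, if_neg (by rintro ⟨-, -, -, -, -, h⟩; omega)]
            · rw [if_neg (by rintro ⟨-, -, -, -, h, -⟩; exact hsw h)]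
              refine finsum_kappaCount_mul_stabiliserWeight_coreHangingTwoStratum_glue_eq_zero hσ hvσ hfix hϖ hd hTr T hT hα hβ h₁ h₂ h₃' hρ hρm hm ?_ i
              rintro ⟨f, hσf, hf⟩
              exact hsw (hswitch.1 ⟨-f, by rw [map_neg, hσf], by rw [show (β - 1) / (α - 1) - -f = f + (β - 1) / (α - 1) by ring]; exact hf⟩)
          · -- `n₃ ≠ m`: then `m < 2ρ+1` (isoceles) and the stratum is empty
            have hm : n₁ < 2 * ρ + 1 := by
              rcases hiso with ⟨-, h13'⟩ | ⟨h, -⟩ | ⟨h, -⟩ <;> omega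
            rw [if_neg (by rintro ⟨-, h, -⟩; exact h13 h),
              coreHangingTwoStratum_eq_empty_of_ne₃ σ hϖ T hT hα hβ h₁ h₂ h₃' hm (Ne.symm h13), finsum_mem_empty]
        · -- `m < ρ + 1`: (S1) fails
          rw [not_le] at hρm
          rw [if_neg (by omega), coreHangingTwoStratum_eq_empty_of_lt σ hϖ T hT hα hβ h₁ h₂ h₃' hρm, finsum_mem_empty]
      · -- off the foot, below the tube: empty
        have hlow : ¬ (2 * ρ + 1 ≤ n₁ ∧ 2 * ρ + 1 ≤ n₂) := by
          rintro ⟨ha, hb⟩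
          rcases hiso with ⟨h, -⟩ | ⟨h, -⟩ | ⟨h, -⟩ <;> omega
        rw [if_neg (by rintro ⟨h, -⟩; exact h12 h), coreHangingTwoStratum_eq_empty_of_ne σ hϖ T hT hα hβ h₁ h₂ h12 hlow, finsum_mem_empty]

end Socket

end Summit.HodgeConjecture.HodgeConjecture.Cruxes.H413.F0P3cDyRamDiagonalKappaCoreHangingTwoSocket

end
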